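import Summits.BirchSwinnertonDyer.Rank1Residual.Additive.X3BranchKummerLayerClasses
import HarnessLib

/-!
# X3, the DEGENERATE rows OFF the sub-locus: the TWISTED Kummer descent — an additive cubic
# character of an open subgroup `G' ≤ Γ_ℚ` NOT containing `μ₃` in its fixed field, from a Kummer
# radical over the quadratic extension by `ζ₃` (cell `bsd-eis`, seat `bsd-eis-x3` gen 7; first brick
# of the T-side over the first layer `ℚ_1` (MEMO-9 §2.3 (f)); route K1 `AdditiveBranchIMC`, crux
# `GordTwoRankZeroOffCaseOne` — supports only)

HONEST FRAMING (`run/shared/lean/pub/bsd-eis/README.md` §4): THEOREMS ONLY (no `def`, no named fact,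
no `sorry`); nothing is booked; no label, tier or count of record moves.

## What

The T-side share `#H¹(ℚ_Σ/ℚ_∞, Φ₀)` of the degenerate certificate road is supplied, on the sub-locus and
on the `U_layer1_only` rows, by the order-`3` sub-characters of the mod-`ℓ` cyclotomic characters
(`X3BranchResidualLineH1LowerBound.lean`, one class per `ℓ ≡ 1 (mod 3)`). For `ℓ ≡ 1 (mod 9)` GV's
count wants THREE classes per `ℓ` — cubic characters of `G₁ = Gal(ℚ̄/ℚ_1)` ramified at ONE of the
three primes `λ_j ∣ ℓ` of `ℚ_1 = ℚ(ζ₉)⁺` (ramification at `3` is allowed in `H¹(ℚ_Σ/ℚ_∞, Φ₀)`). Such a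
character is not a Kummer character over `ℚ_1` (`ζ₃ ∉ ℚ_1`), but over `K = ℚ_1(ζ₃) = ℚ(ζ₉)` it is:
if `b ∈ K` satisfies `b·c(b) = e³` with `e ∈ ℚ_1` (`c` = the non-trivial automorphism of `K/ℚ_1`;
e.g. `b = ϖ·c(ϖ)²`, `ϖ c(ϖ) = π_j`), then for `β³ = b` the rule
`σβ = ζ^{n_σ} β (σζ = ζ)`, `σβ = ζ^{n_σ} e β⁻¹ (σζ = ζ²)`, `χ(σ) = ± n_σ` accordingly,
defines an ADDITIVE CHARACTER `χ : G₁ → ℤ/3` — the descent to `ℚ_1` of the Kummer character of `b`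
twisted by `ω`. This file proves exactly that algebra, `Γ_ℚ`-internally and for any subgroup `G'`:
* `smul_zeta_eq_or` — every `σ ∈ Γ_ℚ` maps a primitive cube root of unity `ζ` to `ζ` or `ζ²`;
* `exists_smul_eq_pow_mul_mul_inv` — the exponent in the twisted case;
* `exists_twistedKummerChar` — the locally constant `χ : Γ_ℚ → ZMod 3`, additive on `G'`, with its
  explicit values on both cosets.
The class in `H¹(H, Φ₀)` (`H ≤ G'`, trivial action), its local conditions and its independence
from the other T-side classes are the successor's files (MEMO-9 §2.4 (f)).
References: [SerreLocalFields1979] Ch. X §3 (Kummer theory); [Washington1997] §10.2 (odd/even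
eigenspaces under `Gal(K/K⁺)`); [GreenbergVatsal2000] §2 pp. 26–30.
-/

set_option autoImplicit false

noncomputable section

open scoped Classical

namespace Summit.BirchSwinnertonDyer.Rank1Residual.Additive

namespace KummerLayerTwisted

open Field Literature.NumberTheory.GaloisRepresentations KummerLineClasses

/-! ### §1 Cube roots of unity under `Γ_ℚ`, and the twisted exponent -/

/-- **`σζ ∈ {ζ, ζ²}`** for a primitive cube root of unity `ζ ∈ ℚ̄` and `σ ∈ Γ_ℚ` (the mod-`3`
cyclotomic character takes the values `1, 2`). [folklore] -/
theorem smul_zeta_eq_or {ζ : AlgebraicClosure ℚ} (hζ : IsPrimitiveRoot ζ 3)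
    (σ : absoluteGaloisGroup ℚ) : σ • ζ = ζ ∨ σ • ζ = ζ ^ 2 := by
  haveI : NeZero ((3 : ℕ) : ℚ) := ⟨by norm_num⟩
  have h := modNCyclotomicCharacter_spec ℚ 3 σ ζ hζ.pow_eq_one
  set u : ZMod 3 := (modNCyclotomicCharacter ℚ 3 σ : ZMod 3) with hu
  have hu0 : u.val ≠ 0 := by
    rw [ne_eq, ZMod.val_eq_zero]
    exact (modNCyclotomicCharacter ℚ 3 σ).ne_zero
  have hu3 : u.val < 3 := ZMod.val_lt u
  have hcases : u.val = 1 ∨ u.val = 2 := by omega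
  rcases hcases with h1 | h2
  · left
    rw [h, h1, pow_one]
  · right
    rw [h, h2]

/-- If `σζ ≠ ζ` then `σζ = ζ²`. [folklore] -/
theorem smul_zeta_eq_sq_of_ne {ζ : AlgebraicClosure ℚ} (hζ : IsPrimitiveRoot ζ 3)
    {σ : absoluteGaloisGroup ℚ} (h : σ • ζ ≠ ζ) : σ • ζ = ζ ^ 2 :=
  (smul_zeta_eq_or hζ σ).resolve_left h

/-- **The twisted exponent.** `β³ = b ≠ 0`, `σb · b = e³`: then `σβ = ζⁿ·e·β⁻¹` for some `n < 3`
(`(σβ·β/e)³ = 1`). [folklore] -/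
theorem exists_smul_eq_pow_mul_mul_inv {ζ : AlgebraicClosure ℚ} (hζ : IsPrimitiveRoot ζ 3)
    {b β e : AlgebraicClosure ℚ} (hb : b ≠ 0) (hβ : β ^ 3 = b) {σ : absoluteGaloisGroup ℚ}
    (hσ : σ • b * b = e ^ 3) : ∃ n : ℕ, n < 3 ∧ σ • β = ζ ^ n * e * β⁻¹ := by
  have hβ0 : β ≠ 0 := by
    rintro rfl
    exact hb (by rw [← hβ]; norm_num)
  have hσb0 : σ • b ≠ 0 := by
    intro h0
    exact hb (smul_eq_zero_iff_eq σ |>.mp h0)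
  have he0 : e ≠ 0 := by
    rintro rfl
    have : σ • b * b = 0 := by rw [hσ]; norm_num
    rcases mul_eq_zero.mp this with h0 | h0
    · exact hσb0 h0
    · exact hb h0
  have hq : (σ • β * β / e) ^ 3 = 1 := by
    rw [div_pow, mul_pow, ← smul_pow', hβ, hσ, div_self (pow_ne_zero 3 he0)]
  obtain ⟨n, hn, hζn⟩ := hζ.eq_pow_of_pow_eq_one hq
  refine ⟨n, hn, ?_⟩
  rw [hζn]
  field_simp

/-- Uniqueness of the twisted exponent modulo `3`: `ζⁿ·x = ζᵐ·x`, `x ≠ 0` ⇒ `n ≡ m (mod 3)`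
(`KummerLineClasses.natCast_eq_of_pow_mul_eq`, restated for readability). [folklore] -/
theorem natCast_eq_of_pow_mul_eq' {ζ : AlgebraicClosure ℚ} (hζ : IsPrimitiveRoot ζ 3)
    {x : AlgebraicClosure ℚ} (hx : x ≠ 0) {n m : ℕ} (h : ζ ^ n * x = ζ ^ m * x) :
    (n : ZMod 3) = m :=
  haveI : Fact (Nat.Prime 3) := ⟨by norm_num⟩
  natCast_eq_of_pow_mul_eq hζ hx h

/-! ### §2 The twisted Kummer character -/

/-- **The TWISTED Kummer descent.** `G' ≤ Γ_ℚ`; `ζ ∈ ℚ̄` a primitive cube root of unity; `β³ = b ≠ 0`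
with `b` fixed by every `σ ∈ G'` fixing `ζ` and `σb·b = e³` for every `σ ∈ G'` moving `ζ`, where
`e` is fixed by `G'`. Then there is a locally constant `χ : Γ_ℚ → ℤ/3`, ADDITIVE on `G'`
(`χ(στ) = χ(σ) + χ(τ)`), with `σβ = ζ^{n}β`, `χ(σ) = n` when `σζ = ζ` and `σβ = ζ^{n}eβ⁻¹`,
`χ(σ) = −n` when `σζ ≠ ζ` (`σ ∈ G'`). Stated as an existence (no definition).
[cite: SerreLocalFields1979, Ch. X §3] [cite: Washington1997, §10.2] -/
theorem exists_twistedKummerChar (G' : Subgroup (absoluteGaloisGroup ℚ))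
    {ζ : AlgebraicClosure ℚ} (hζ : IsPrimitiveRoot ζ 3)
    {b β e : AlgebraicClosure ℚ} (hb : b ≠ 0) (hβ : β ^ 3 = b) (heG : ∀ σ ∈ G', σ • e = e)
    (hfix : ∀ σ ∈ G', σ • ζ = ζ → σ • b = b)
    (hflip : ∀ σ ∈ G', σ • ζ ≠ ζ → σ • b * b = e ^ 3) :
    ∃ χ : absoluteGaloisGroup ℚ → ZMod 3, IsLocallyConstant χ ∧
      (∀ σ ∈ G', ∀ τ ∈ G', χ (σ * τ) = χ σ + χ τ) ∧
      (∀ σ ∈ G', σ • ζ = ζ → ∃ n : ℕ, σ • β = ζ ^ n * β ∧ χ σ = n) ∧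
      (∀ σ ∈ G', σ • ζ ≠ ζ → ∃ n : ℕ, σ • β = ζ ^ n * e * β⁻¹ ∧ χ σ = -(n : ZMod 3)) := by
  haveI : NeZero (3 : ℕ) := ⟨by norm_num⟩
  have hβ0 : β ≠ 0 := by
    rintro rfl
    exact hb (by rw [← hβ]; norm_num)
  have hζ3 : ζ ^ 3 = 1 := hζ.pow_eq_one
  have hζ0 : ζ ≠ 0 := hζ.ne_zero (by norm_num)
  -- the exponents, as functions of the pair `(σζ, σβ)`
  let n₁ : AlgebraicClosure ℚ → ℕ := fun x ↦
    if h : ∃ n : ℕ, n < 3 ∧ x = ζ ^ n * β then Classical.choose h else 0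
  let n₂ : AlgebraicClosure ℚ → ℕ := fun x ↦
    if h : ∃ n : ℕ, n < 3 ∧ x = ζ ^ n * e * β⁻¹ then Classical.choose h else 0
  let F : AlgebraicClosure ℚ × AlgebraicClosure ℚ → ZMod 3 := fun zx ↦
    if zx.1 = ζ then (n₁ zx.2 : ZMod 3) else -(n₂ zx.2 : ZMod 3)
  let χ : absoluteGaloisGroup ℚ → ZMod 3 := fun σ ↦ F (σ • ζ, σ • β)
  have hn₁ : ∀ σ ∈ G', σ • ζ = ζ → σ • β = ζ ^ n₁ (σ • β) * β := fun σ hσ hz ↦ by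
    have h : ∃ n : ℕ, n < 3 ∧ σ • β = ζ ^ n * β :=
      KummerLayerClasses.exists_smul_eq_pow_mul hζ hb hβ (hfix σ hσ hz)
    simp only [n₁, dif_pos h]
    exact (Classical.choose_spec h).2
  have hn₂ : ∀ σ ∈ G', σ • ζ ≠ ζ → σ • β = ζ ^ n₂ (σ • β) * e * β⁻¹ := fun σ hσ hz ↦ by
    have h : ∃ n : ℕ, n < 3 ∧ σ • β = ζ ^ n * e * β⁻¹ :=
      exists_smul_eq_pow_mul_mul_inv hζ hb hβ (hflip σ hσ hz)
    simp only [n₂, dif_pos h]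
    exact (Classical.choose_spec h).2
  have hχ₁ : ∀ σ, σ • ζ = ζ → χ σ = (n₁ (σ • β) : ZMod 3) := fun σ hz ↦ by
    simp only [χ, F, hz, if_true]
  have hχ₂ : ∀ σ, σ • ζ ≠ ζ → χ σ = -(n₂ (σ • β) : ZMod 3) := fun σ hz ↦ by
    simp only [χ, F, hz, if_false]
  -- `e ≠ 0` as soon as some element of `G'` moves `ζ`
  have he0 : ∀ σ ∈ G', σ • ζ ≠ ζ → e ≠ 0 := fun σ hσ hz he ↦ by
    have h := hflip σ hσ hz
    rw [he, zero_pow three_ne_zero, mul_eq_zero] at h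
    rcases h with h0 | h0
    · exact hb ((smul_eq_zero_iff_eq σ).mp h0)
    · exact hb h0
  have h30 : (3 : ZMod 3) = 0 := by decide
  have hζ21 : ζ ^ 2 ≠ ζ := fun h ↦
    hζ.ne_one (by norm_num) (mul_left_cancel₀ hζ0 (by rw [← pow_two, h, mul_one]))
  refine ⟨χ, ?_, fun σ hσ τ hτ ↦ ?_, fun σ hσ hz ↦ ⟨n₁ (σ • β), hn₁ σ hσ hz, hχ₁ σ hz⟩,
    fun σ hσ hz ↦ ⟨n₂ (σ • β), hn₂ σ hσ hz, hχ₂ σ hz⟩⟩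
  · -- locally constant through `σ ↦ (σζ, σβ)`
    exact ((isLocallyConstant_smul ζ).prodMk (isLocallyConstant_smul β)).comp F
  · -- additivity on `G'`: four cases according to the action on `ζ`
    have hστG : σ * τ ∈ G' := G'.mul_mem hσ hτ
    rcases smul_zeta_eq_or hζ σ with hsz | hsz <;> rcases smul_zeta_eq_or hζ τ with htz | htz
    · -- `σζ = ζ`, `τζ = ζ`: `(στ)ζ = ζ`
      have hstz : (σ * τ) • ζ = ζ := by rw [mul_smul, htz, hsz]
      rw [hχ₁ _ hstz, hχ₁ _ hsz, hχ₁ _ htz]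
      have hs := hn₁ σ hσ hsz
      have ht := hn₁ τ hτ htz
      have hst := hn₁ (σ * τ) hστG hstz
      generalize n₁ (σ • β) = cσ at hs ⊢
      generalize n₁ (τ • β) = cτ at ht ⊢
      generalize n₁ ((σ * τ) • β) = cστ at hst ⊢
      have key : ζ ^ cστ * β = ζ ^ (cσ + cτ) * β := by
        rw [← hst, mul_smul, ht, smul_mul', smul_pow', hsz, hs]
        ring
      have hc := natCast_eq_of_pow_mul_eq' hζ hβ0 key
      push_cast at hc
      linear_combination hc
    · -- `σζ = ζ`, `τζ = ζ²`: `(στ)ζ = ζ²`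
      have htz' : τ • ζ ≠ ζ := by rw [htz]; exact hζ21
      have hstz' : (σ * τ) • ζ ≠ ζ := by rw [mul_smul, htz, smul_pow', hsz]; exact hζ21
      rw [hχ₂ _ hstz', hχ₁ _ hsz, hχ₂ _ htz']
      have hs := hn₁ σ hσ hsz
      have ht := hn₂ τ hτ htz'
      have hst := hn₂ (σ * τ) hστG hstz'
      have he := he0 τ hτ htz'
      generalize n₁ (σ • β) = cσ at hs ⊢
      generalize n₂ (τ • β) = cτ at ht ⊢
      generalize n₂ ((σ * τ) • β) = cστ at hst ⊢
      have h1 : (ζ ^ cσ) ^ 3 = 1 := by rw [← pow_mul, mul_comm, pow_mul, hζ3, one_pow]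
      have key : ζ ^ cστ * (e * β⁻¹) = ζ ^ (cτ + 2 * cσ) * (e * β⁻¹) := by
        rw [← mul_assoc, ← hst, mul_smul, ht, smul_mul', smul_mul', smul_pow', hsz, heG σ hσ, smul_inv'', hs]
        field_simp
        linear_combination (-(ζ ^ cτ)) * h1
      have hc := natCast_eq_of_pow_mul_eq' hζ (mul_ne_zero he (inv_ne_zero hβ0)) key
      push_cast at hc
      linear_combination (-1 : ZMod 3) * hc + (-(cσ : ZMod 3)) * h30
    · -- `σζ = ζ²`, `τζ = ζ`: `(στ)ζ = ζ²`
      have hsz' : σ • ζ ≠ ζ := by rw [hsz]; exact hζ21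
      have hstz' : (σ * τ) • ζ ≠ ζ := by rw [mul_smul, htz, hsz]; exact hζ21
      rw [hχ₂ _ hstz', hχ₂ _ hsz', hχ₁ _ htz]
      have hs := hn₂ σ hσ hsz'
      have ht := hn₁ τ hτ htz
      have hst := hn₂ (σ * τ) hστG hstz'
      have he := he0 σ hσ hsz'
      generalize n₂ (σ • β) = cσ at hs ⊢
      generalize n₁ (τ • β) = cτ at ht ⊢
      generalize n₂ ((σ * τ) • β) = cστ at hst ⊢
      have key : ζ ^ cστ * (e * β⁻¹) = ζ ^ (2 * cτ + cσ) * (e * β⁻¹) := by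
        rw [← mul_assoc, ← hst, mul_smul, ht, smul_mul', smul_pow', hsz, hs]
        ring
      have hc := natCast_eq_of_pow_mul_eq' hζ (mul_ne_zero he (inv_ne_zero hβ0)) key
      push_cast at hc
      linear_combination (-1 : ZMod 3) * hc + (-(cτ : ZMod 3)) * h30
    · -- `σζ = ζ²`, `τζ = ζ²`: `(στ)ζ = ζ⁴ = ζ`
      have hsz' : σ • ζ ≠ ζ := by rw [hsz]; exact hζ21
      have htz' : τ • ζ ≠ ζ := by rw [htz]; exact hζ21
      have hstz : (σ * τ) • ζ = ζ := by
        rw [mul_smul, htz, smul_pow', hsz, ← pow_mul, show 2 * 2 = 3 + 1 from rfl, pow_succ, hζ3, one_mul]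
      rw [hχ₁ _ hstz, hχ₂ _ hsz', hχ₂ _ htz']
      have hs := hn₂ σ hσ hsz'
      have ht := hn₂ τ hτ htz'
      have hst := hn₁ (σ * τ) hστG hstz
      have he := he0 σ hσ hsz'
      generalize n₂ (σ • β) = cσ at hs ⊢
      generalize n₂ (τ • β) = cτ at ht ⊢
      generalize n₁ ((σ * τ) • β) = cστ at hst ⊢
      have h1 : (ζ ^ cσ) ^ 3 = 1 := by rw [← pow_mul, mul_comm, pow_mul, hζ3, one_pow]
      have key : ζ ^ cστ * β = ζ ^ (2 * cτ + 2 * cσ) * β := by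
        rw [← hst, mul_smul, ht, smul_mul', smul_mul', smul_pow', hsz, heG σ hσ, smul_inv'', hs]
        field_simp
        linear_combination (-(ζ ^ (2 * cτ))) * h1
      have hc := natCast_eq_of_pow_mul_eq' hζ hβ0 key
      push_cast at hc
      linear_combination hc + ((cσ : ZMod 3) + cτ) * h30

end KummerLayerTwisted

end Summit.BirchSwinnertonDyer.Rank1Residual.Additive

end
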